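import Literature.Topology.FourManifolds.KnotWindingHypotheses
import Literature.AlgebraicTopology.SingularHomology.SphereComplementDegree
import Literature.AlgebraicTopology.SingularHomology.HurewiczProofs
import HarnessLib

/-!
# Homology of a knot complement: `H₂ = 0`, `H₁ ≅ ℤ`, and circle maps of winding one

Topic `Literature/Topology/FourManifolds`; the remaining generic inputs `h2` and (via
`CutHomologyVanishing.lean`) `hY`, `hN` of the square presentation of the Alexander module
(`KnotSquarePresentation.lean`). For a knot `K ⊂ S³`:

* `Knot.isZero_singularHomology_complement` — `Hᵢ(S³ ∖ K; M) = 0` for `i ≥ 2`, and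
  `Knot.nonempty_singularHomology_complement_one_iso` — `H₁(S³ ∖ K; M) ≅ M`: Alexander duality
  for the embedded circle, in the tree as Hatcher's Prop. 2B.1(b)
  (`SphereComplement.isZero_compl_range_of_isEmbedding_holds`,
  `SphereComplement.nonempty_compl_range_iso_coeff_of_isEmbedding`);
* `Knot.TubularNbhd.injective_map_of_winding_meridian` — **if the meridian winds once along
  `f : S³ ∖ K → S¹` then `f_* : H₁(S³ ∖ K; ℤ) → H₁(S¹; ℤ)` is injective**: by the Hurewicz
  theorem (`hurewiczOneAb` bijective, Hatcher Thm. 2A.1) a class is `h[γ]`, `f_* h[γ] = h[f ∘ γ]`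
  (naturality), and `h[f ∘ γ] = 0` forces the winding number of `f ∘ γ` to vanish, i.e.
  `[γ] ∈ ker f_* = [π₁, π₁]` (`Knot.TubularNbhd.ker_windingHom_eq_commutator`: the meridian
  generates `H₁`; Rolfsen (1976), §3.B, §7.A), so `h[γ] = 0`.

Everything is proved; no named fact is introduced.

## References

* A. Hatcher, *Algebraic Topology* (2002), Prop. 2B.1(b), Thm. 2A.1. [HatcherAT2002]
* D. Rolfsen, *Knots and Links*, Publish or Perish (1976), §3.B, §5.D, §7.A. [Rolfsen1976]
-/

noncomputable section

open Set Function Multiplicative CategoryTheory Limits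
open Literature.AlgebraicTopology.SingularHomology
open Literature.Topology.FourManifolds.CircleMaps

namespace Literature.Topology.FourManifolds

namespace Knot

variable (K : Knot)

/-- **`Hᵢ(S³ ∖ K; M) = 0` for `i ≥ 2`** (Alexander duality for a knot; Hatcher 2002,
Prop. 2B.1(b): the complement of an embedded `S¹ ⊂ S³` has the homology of a circle).
[cite: HatcherAT2002, Prop. 2B.1(b)] -/
theorem isZero_singularHomology_complement (R : Type) [CommRing R] (M : Type) [AddCommGroup M]
    [Module R M] {i : ℕ} (hi : 2 ≤ i) : IsZero (singularHomology R M K.complement i) :=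
  SphereComplement.isZero_compl_range_of_isEmbedding_holds R M (k := 1) (n := 3) K K.isEmbedding
    (by norm_num) (by omega) (by omega)

/-- **`H₁(S³ ∖ K; M) ≅ M`** (Hatcher 2002, Prop. 2B.1(b)). [cite: HatcherAT2002, Prop. 2B.1(b)] -/
theorem nonempty_singularHomology_complement_one_iso (R : Type) [CommRing R] (M : Type)
    [AddCommGroup M] [Module R M] :
    Nonempty (singularHomology R M K.complement 1 ≅ ModuleCat.of R (ULift M)) :=
  SphereComplement.nonempty_compl_range_iso_coeff_of_isEmbedding R M (k := 1) (m := 2) K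
    K.isEmbedding le_rfl

end Knot

namespace Knot.TubularNbhd

variable {K : Knot} (ν : Knot.TubularNbhd K)

/-- **A circle map along which the meridian winds once is injective on `H₁(S³ ∖ K; ℤ)`**
(Rolfsen 1976, §5.D with §7.A; Hatcher 2002, Thm. 2A.1): see the module docstring.
[cite: Rolfsen1976, §7.A] [cite: HatcherAT2002, Thm. 2A.1] -/
theorem injective_map_of_winding_meridian (f : C(K.complement, Circle))
    (h₀ : winding f ν.meridian = 1) :
    Function.Injective (singularHomology.map ℤ ℤ f 1) := by
  haveI : PathConnectedSpace K.complement := ν.pathConnectedSpace_complement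
  -- it suffices to show that the kernel is trivial
  suffices hker : ∀ z : singularHomology ℤ ℤ K.complement 1,
      singularHomology.map ℤ ℤ f 1 z = 0 → z = 0 by
    intro z₁ z₂ h
    rw [← sub_eq_zero] at h ⊢
    exact hker _ (by rwa [map_sub])
  intro z hz
  -- `z = h[γ]` for a loop `γ` at the base point (Hurewicz is onto)
  obtain ⟨a, ha⟩ := HurewiczProof.hurewiczOneAb_surjective ν.basePoint (ofAdd z)
  obtain ⟨g, rfl⟩ := QuotientGroup.mk_surjective a
  induction g using Quotient.ind with
  | _ γ =>
    change hurewiczOneAb ℤ ℤ (1 : ℤ) ν.basePoint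
      (Abelianization.of (FundamentalGroup.fromPath (Path.Homotopic.Quotient.mk γ))) = ofAdd z at ha
    rw [hurewiczOneAb_of_fromPath] at ha
    have hzγ : loopClass ℤ ℤ (1 : ℤ) γ = z := ofAdd.injective ha
    -- naturality: `f_* h[γ] = h[f ∘ γ]`, so `h[f ∘ γ] = 0` in `H₁(S¹)`
    have h1 : loopClass ℤ ℤ (1 : ℤ) (γ.map f.continuous) = 0 := by
      rw [← map_loopClass, hzγ, hz]
    -- Hurewicz for the circle is injective: `[f ∘ γ]ᵃᵇ = 1`
    have h2 : Abelianization.of (FundamentalGroup.fromPath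
        (Path.Homotopic.Quotient.mk (γ.map f.continuous))) = 1 := by
      apply HurewiczProof.hurewiczOneAb_injective (f ν.basePoint)
      rw [hurewiczOneAb_of_fromPath, h1, map_one, ofAdd_zero]
    -- hence the winding number of `f ∘ γ`, i.e. of `γ` along `f`, vanishes
    have h3 : winding f γ = 0 := by
      have h := congrArg (Abelianization.lift (windingHom (ContinuousMap.id Circle) (f ν.basePoint))) h2
      rw [Abelianization.lift_apply_of, windingHom_fromPath, map_one] at h
      rw [winding_congr f (ContinuousMap.id Circle) γ (γ.map f.continuous) (fun t => rfl)]
      exact ofAdd_eq_one.1 h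
    -- so `[γ]` lies in `ker f_* = [π₁, π₁] = ker (π₁ → π₁ᵃᵇ)`
    have h4 : FundamentalGroup.fromPath (Path.Homotopic.Quotient.mk γ) ∈
        (windingHom f ν.basePoint).ker := by
      rw [MonoidHom.mem_ker, windingHom_fromPath, h3, ofAdd_zero]
    rw [ν.ker_windingHom_eq_commutator h₀, ← Abelianization.ker_of, MonoidHom.mem_ker] at h4
    -- and `z = h̄[γ]ᵃᵇ = h̄ 1 = 0`
    have h5 := hurewiczOneAb_of_fromPath (R := ℤ) (M := ℤ) (m := (1 : ℤ)) γ
    rw [h4, map_one, hzγ] at h5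
    exact (ofAdd_eq_one.1 h5.symm)

end Knot.TubularNbhd

end Literature.Topology.FourManifolds
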